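import Mathlib
import Summits.NavierStokesRegularity.OSWSelfSimilar.HouLuoViscousThetaFloor
import HarnessLib

/-!
# Viscous Hou–Luo profile MODEL: a closed-form instance of the hypotheses of the floor theorem (non-vacuity)

HONEST FRAMING (cell ns-blowup GROUP B, zone Z3; human rulings D-0035/D-0074): **1-D MODEL calculus; not Euler,
not Navier–Stokes; «violates: none — MODEL».** This file is the tree version of profile-refuter g3's probe
`HOME/profile/refuter/Probe6-ThetaFloor-nonvacuity.lean` (sha16 697f8c8a7b97f302, KILLSHEET-B v0.29 block (6)),
landed by profile-eng-3 g4 at the refuter's invitation; the mathematics is the refuter's.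

WHAT IT SHOWS. The hypotheses of `HouLuoViscousThetaFloor.two_comega_le_cl` — `C²` profiles `(Ω, Theta)` tending to `0`
at `±∞`, `F₁ ≡ 0` (with `b = 0`) and the temperature equation `FΘ ≡ 0` (with `c_θ = 2c_ω − c_l`) for SOME functions
`𝒰, HΩ`, `ε_ω, ε_θ ≥ 0`, `c_ω > 0`, `Theta ≢ 0` — are JOINTLY SATISFIABLE, by the closed-form pair
`Theta(ξ) = e^{−ξ²/2}`, `P = Θ′ = −ξe^{−ξ²/2}`, `Ω(ξ) = −ξe^{−ξ²/2}/3`, with `(c_ω, c_l, a, b, ε_ω, ε_θ) = (1, 3, 1, 0, 1, 1)`,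
drift `𝒰(ξ) = −4ξ` and `H ≡ −4 = 𝒰′` (both equations then hold identically, by `ring`). So the floor `2c_ω ≤ c_l` is a
statement about a non-empty class, and the instance sits ABOVE the floor (`c_l = 3 = 2c_ω + 1`), as it must.
WHAT IT IS NOT. `H ≡ −4` is NOT the Hilbert transform of this `Ω` and `𝒰 = −4ξ` is not its velocity: the floor theorem
treats `𝒰, HΩ` as arbitrary functions (exactly as `HouLuoOriginLaws`), and this witness exercises the hypotheses AS TYPED —
it is not a Hou–Luo profile and asserts nothing about the existence of one (those exist in print: CHH 2022, HQWW 2025,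
`c_l ∈ (2, 4.53)`). bears_on: LADDER-NS N5 / zone Z3 → N1 linear core; SELFSIM-NOGO (M8) MODEL side.
-/

noncomputable section
open Filter Topology

namespace Summit.NavierStokesRegularity.OSWSelfSimilar
namespace HouLuoViscousThetaFloorWitness

open HouLuoOriginLaws (F1)
open HouLuoViscousThetaFloor (FTheta two_comega_le_cl)

/-- The Gaussian `g(ξ) = e^{−ξ²/2}`. [new here — MODEL witness, after profile-refuter g3's Probe6] -/
def g (ξ : ℝ) : ℝ := Real.exp (-(ξ ^ 2) / 2)

/-- Temperature profile of the witness, `Theta = g`. [new here — MODEL witness] -/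
def Theta (ξ : ℝ) : ℝ := g ξ

/-- `P = Θ′ = −ξ g`. [new here — MODEL witness] -/
def P (ξ : ℝ) : ℝ := -ξ * g ξ

/-- `P′ = (ξ² − 1) g`. [new here — MODEL witness] -/
def dP (ξ : ℝ) : ℝ := (ξ ^ 2 - 1) * g ξ

/-- Vorticity profile of the witness, `Ω = −ξ g/3`. [new here — MODEL witness] -/
def Om (ξ : ℝ) : ℝ := -(ξ * g ξ) / 3

/-- `Ω′ = −(1 − ξ²) g/3`. [new here — MODEL witness] -/
def dOm (ξ : ℝ) : ℝ := -((1 - ξ ^ 2) * g ξ) / 3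

/-- `Ω″ = −(ξ³ − 3ξ) g/3`. [new here — MODEL witness] -/
def ddOm (ξ : ℝ) : ℝ := -((ξ ^ 3 - 3 * ξ) * g ξ) / 3

/-- The drift of the witness, `𝒰(ξ) = −4ξ` (an arbitrary function in the floor theorem; NOT the Hou–Luo velocity of `Ω`).
[new here — MODEL witness] -/
def U (ξ : ℝ) : ℝ := -4 * ξ

/-- The `HΩ`-slot of the witness, `H ≡ −4 = 𝒰′` (NOT the Hilbert transform of `Ω`). [new here — MODEL witness] -/
def H (_ξ : ℝ) : ℝ := -4

/-- `g > 0`. [new here — MODEL witness] -/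
theorem g_pos (ξ : ℝ) : 0 < g ξ := Real.exp_pos _

/-- `g′ = −ξ g`. [new here — MODEL witness] -/
theorem hasDerivAt_g (ξ : ℝ) : HasDerivAt g (-ξ * g ξ) ξ := by
  have h1 : HasDerivAt (fun x : ℝ => x ^ 2) (2 * ξ) ξ := by simpa using hasDerivAt_pow 2 ξ
  have h2 : HasDerivAt (fun x : ℝ => -(x ^ 2) / 2) (-(2 * ξ) / 2) ξ := (h1.neg).div_const 2
  show HasDerivAt (fun x : ℝ => Real.exp (-(x ^ 2) / 2)) (-ξ * g ξ) ξ
  refine h2.exp.congr_deriv ?_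
  unfold g; ring

/-- `Θ′ = P`. [new here — MODEL witness] -/
theorem hasDerivAt_Theta (ξ : ℝ) : HasDerivAt Theta (P ξ) ξ := by
  show HasDerivAt (fun x => g x) (-ξ * g ξ) ξ
  exact hasDerivAt_g ξ

/-- `P′ = dP`. [new here — MODEL witness] -/
theorem hasDerivAt_P (ξ : ℝ) : HasDerivAt P (dP ξ) ξ := by
  have h := ((hasDerivAt_id' ξ).neg).mul (hasDerivAt_g ξ)
  show HasDerivAt (fun x : ℝ => -x * g x) (dP ξ) ξ
  refine h.congr_deriv ?_
  unfold dP; simp only [Pi.neg_apply]; ring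

/-- `Ω′ = dOm`. [new here — MODEL witness] -/
theorem hasDerivAt_Om (ξ : ℝ) : HasDerivAt Om (dOm ξ) ξ := by
  have h := (((hasDerivAt_id' ξ).mul (hasDerivAt_g ξ)).neg).div_const 3
  show HasDerivAt (fun x : ℝ => -(x * g x) / 3) (dOm ξ) ξ
  refine h.congr_deriv ?_
  unfold dOm; ring

/-- `Ω″ = ddOm`. [new here — MODEL witness] -/
theorem hasDerivAt_dOm (ξ : ℝ) : HasDerivAt dOm (ddOm ξ) ξ := by
  have h0 : HasDerivAt (fun x : ℝ => x ^ 2) (2 * ξ) ξ := by simpa using hasDerivAt_pow 2 ξ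
  have h1 : HasDerivAt (fun x : ℝ => 1 - x ^ 2) (-(2 * ξ)) ξ := h0.const_sub 1
  have h := ((h1.mul (hasDerivAt_g ξ)).neg).div_const 3
  show HasDerivAt (fun x : ℝ => -((1 - x ^ 2) * g x) / 3) (ddOm ξ) ξ
  refine h.congr_deriv ?_
  unfold ddOm; ring

/-- `−ξ²/2 → −∞` along the cocompact filter. [folklore] -/
theorem tendsto_negSqHalf : Tendsto (fun ξ : ℝ => -(ξ ^ 2) / 2) (cocompact ℝ) atBot := by
  have h1 : Tendsto (fun ξ : ℝ => ‖ξ‖ ^ 2) (cocompact ℝ) atTop :=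
    (tendsto_pow_atTop two_ne_zero).comp tendsto_norm_cocompact_atTop
  have h2 : Tendsto (fun ξ : ℝ => ξ ^ 2) (cocompact ℝ) atTop :=
    (tendsto_congr (fun ξ => by rw [Real.norm_eq_abs, sq_abs])).mp h1
  have h3 : Tendsto (fun ξ : ℝ => -(ξ ^ 2)) (cocompact ℝ) atBot := tendsto_neg_atTop_atBot.comp h2
  exact h3.atBot_div_const (by norm_num : (0:ℝ) < 2)

/-- `g → 0` at `±∞`. [folklore] -/
theorem tendsto_g : Tendsto g (cocompact ℝ) (𝓝 0) :=
  Real.tendsto_exp_atBot.comp tendsto_negSqHalf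

/-- `Theta → 0` at `±∞`. [new here — MODEL witness] -/
theorem tendsto_Theta : Tendsto Theta (cocompact ℝ) (𝓝 0) := tendsto_g

/-- `ξ g(ξ) → 0` as `ξ → +∞`. [folklore] -/
theorem tendsto_mul_g_atTop : Tendsto (fun ξ : ℝ => ξ * g ξ) atTop (𝓝 0) := by
  have hu : Tendsto (fun x : ℝ => x * Real.exp (-(1 / 2) * x)) atTop (𝓝 0) := by
    have := tendsto_rpow_mul_exp_neg_mul_atTop_nhds_zero 1 (1 / 2) (by norm_num)
    simpa [Real.rpow_one] using this
  refine tendsto_of_tendsto_of_tendsto_of_le_of_le' tendsto_const_nhds hu ?_ ?_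
  · filter_upwards [eventually_ge_atTop (1 : ℝ)] with ξ hξ
    exact mul_nonneg (by linarith) (g_pos ξ).le
  · filter_upwards [eventually_ge_atTop (1 : ℝ)] with ξ hξ
    have hξ0 : 0 ≤ ξ := by linarith
    refine mul_le_mul_of_nonneg_left ?_ hξ0
    unfold g
    refine Real.exp_le_exp.mpr ?_
    nlinarith

/-- `ξ g(ξ) → 0` as `ξ → −∞` (odd symmetry). [folklore] -/
theorem tendsto_mul_g_atBot : Tendsto (fun ξ : ℝ => ξ * g ξ) atBot (𝓝 0) := by
  have h := (tendsto_mul_g_atTop.comp tendsto_neg_atBot_atTop).neg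
  have hfun : (fun ξ : ℝ => ξ * g ξ) = fun ξ => -(((fun y : ℝ => y * g y) ∘ Neg.neg) ξ) := by
    funext ξ
    simp only [Function.comp, g, neg_sq]
    ring
  rw [hfun]
  simpa using h

/-- `ξ g(ξ) → 0` at `±∞`. [folklore] -/
theorem tendsto_mul_g : Tendsto (fun ξ : ℝ => ξ * g ξ) (cocompact ℝ) (𝓝 0) := by
  rw [cocompact_eq_atBot_atTop, tendsto_sup]
  exact ⟨tendsto_mul_g_atBot, tendsto_mul_g_atTop⟩

/-- `Ω → 0` at `±∞`. [new here — MODEL witness] -/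
theorem tendsto_Om : Tendsto Om (cocompact ℝ) (𝓝 0) := by
  have h := (tendsto_mul_g.neg).div_const 3
  show Tendsto (fun ξ : ℝ => -(ξ * g ξ) / 3) (cocompact ℝ) (𝓝 0)
  simpa using h

/-- `Theta ≢ 0` (`Theta(0) = 1`). [new here — MODEL witness] -/
theorem Theta_ne_zero : Theta ≠ 0 := by
  intro h
  have := congrFun h 0
  simp [Theta, g] at this

/-- The vorticity equation `F₁ ≡ 0` holds identically for the witness at `(c_ω, c_l, a, b, ε_ω) = (1, 3, 1, 0, 1)`.
[new here — MODEL witness] -/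
theorem F1_eq_zero (ξ : ℝ) : F1 1 3 1 0 1 H U Om dOm ddOm P ξ = 0 := by
  unfold F1 H U Om dOm ddOm P; ring

/-- The temperature equation `FΘ ≡ 0` holds identically for the witness with `c_θ = 2·1 − 3 = −1`, `ε_θ = 1`.
[new here — MODEL witness] -/
theorem FTheta_eq_zero (ξ : ℝ) : FTheta (2 * 1 - 3) 3 1 1 U Theta P dP ξ = 0 := by
  unfold FTheta U Theta P dP; ring

/-- **The floor theorem applied to the witness** (`2·1 ≤ 3` obtained THROUGH `two_comega_le_cl`, i.e. every hypothesis
discharged for a nontrivial decaying `C^∞` pair): the hypothesis class of the floor is non-empty. [new here — MODEL witness] -/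
theorem floor_applied : 2 * (1 : ℝ) ≤ 3 :=
  two_comega_le_cl 1 3 1 1 1 H U Om dOm ddOm Theta P dP (by norm_num) (by norm_num) one_pos
    F1_eq_zero FTheta_eq_zero hasDerivAt_Om hasDerivAt_dOm hasDerivAt_Theta hasDerivAt_P tendsto_Om tendsto_Theta
    (Or.inl Theta_ne_zero)

/-- **Non-vacuity of `two_comega_le_cl`, as an existence statement**: there are exponents with `c_ω > 0`, viscosities
`ε_ω, ε_θ ≥ 0`, functions `𝒰, HΩ` and a nontrivial decaying `C²` pair `(Ω, Theta)` (with `P = Θ′`) satisfying every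
hypothesis of the floor theorem — here at `c_l = 3`, one unit above the floor `2c_ω = 2`. [new here — MODEL witness] -/
theorem exists_instance :
    ∃ (cω cl a εω εθ : ℝ) (H U Om dOm ddOm Theta P dP : ℝ → ℝ),
      0 ≤ εω ∧ 0 ≤ εθ ∧ 0 < cω ∧ (∀ ξ, F1 cω cl a 0 εω H U Om dOm ddOm P ξ = 0) ∧
      (∀ ξ, FTheta (2 * cω - cl) cl a εθ U Theta P dP ξ = 0) ∧
      (∀ x, HasDerivAt Om (dOm x) x) ∧ (∀ x, HasDerivAt dOm (ddOm x) x) ∧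
      (∀ x, HasDerivAt Theta (P x) x) ∧ (∀ x, HasDerivAt P (dP x) x) ∧
      Tendsto Om (cocompact ℝ) (𝓝 0) ∧ Tendsto Theta (cocompact ℝ) (𝓝 0) ∧ Theta ≠ 0 ∧ cl = 2 * cω + 1 :=
  ⟨1, 3, 1, 1, 1, H, U, Om, dOm, ddOm, Theta, P, dP, by norm_num, by norm_num, one_pos, F1_eq_zero, FTheta_eq_zero,
    hasDerivAt_Om, hasDerivAt_dOm, hasDerivAt_Theta, hasDerivAt_P, tendsto_Om, tendsto_Theta, Theta_ne_zero, by norm_num⟩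

end HouLuoViscousThetaFloorWitness
end Summit.NavierStokesRegularity.OSWSelfSimilar
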